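import Summits.BirchSwinnertonDyer.BirchSwinnertonDyer.Theorems.ErratumRoadFiveBdvCalibrationSplitNFCalibratorSupplyFirr
import Literature.NumberTheory.GaloisCohomology.Howard2004.ChebotarevInertPrimesProofs
import Literature.NumberTheory.GaloisRepresentations.FrobeniusDensity
import Literature.NumberTheory.QuadraticFields.KroneckerSplitting
import Literature.NumberTheory.EllipticCurves.StrictSelmerRankOneDegreeOneProofs
import Summits.BirchSwinnertonDyer.Rank1Residual.X11b.SplitPrimeUnramified
import HarnessLib

/-!
# Calibrator supply S2a-NF from three named printed facts — BUILT port of the «F-irr» Sketch, file 2/3: PART B–C (CM docking)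

1:1 port (file 2 of 3) of `Cruxes/EulerHalfNotRamNoInertSetAtFive/Lines/calibrator_Firr_Sketch.lean` rev 1.2 —
**bytes: bsd-idea-9 g55, Cruxes/EulerHalfNotRamNoInertSetAtFive/Lines/calibrator_Firr_Sketch.lean rev 1.2 (c83736268e5f3766)**;
port record and deltas in file 1 `…Theorems.ErratumRoadFiveBdvCalibrationSplitNFCalibratorSupplyFirr`.  Public here, reusable by the
`exc` twin ∕ item 33168: `isResiduallyAbsIrreducible_of_CM`, `isResiduallyAbsIrreducible_of_CM_clause`.
Ported by the LEAD lineage bsd-line-er5-p1 (g21) on SUMMON key `s2aport` (pen bsd-stepL-plan g53; authority director-bsd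
(778) (σ1)); `--supports stmt-BirchSwinnertonDyer-33169`.  HELPER ONLY: closes no registered stub by signature; PART E
`calibratorSupplyNF_of_printedFacts` makes S2a-NF (`stub_calibratorSupplyNF` of 33169 r3, token for token) a consequence
of THREE NAMED PRINTED FACTS `hW`, `h61`, `hPRE` — a conditional theorem, not a proof of S2a-NF; typed ≠ proved; no
summit statement is proved here; BSD is proved for no curve.

The Sketch's module docstring, PART B–C paragraph, verbatim:

PART B (docking, BSTW24 App. B currency): for the CM calibrator `g ∈ S₂(Γ₀(N))` — CM clause
`χ_K(ℓ) a_ℓ = a_ℓ (ℓ ∤ N)` by an imaginary quadratic `K` with `p` split in `K`, VERBATIM the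
`K`-conjunct of `BurungaleSkinnerTianWan2024.prop523proof_appB_exists_orientedCMNewform_PRE` —
the traces of `ρ_{g,ι'}` vanish off `Γ_K` (Čebotarev density, PROVED in the tree, + inert primes
have `a_ℓ = 0` + Deligne's `tr ρ(Frob_ℓ) = a_ℓ`) and `I_p ≤ Γ_K`; Part A applies:
`isResiduallyAbsIrreducible_of_CM`.  PART C: the same with the `K`-clause kept existential
(`isResiduallyAbsIrreducible_of_CM_clause`), token-identical to the PRE fact's output.
-/

-- D-0017: single-problem summit, so `Summit.BirchSwinnertonDyer.BirchSwinnertonDyer.…` repeats a namespace BY DESIGN.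
set_option linter.dupNamespace false

namespace Summit.BirchSwinnertonDyer.BirchSwinnertonDyer.Theorems.ErratumRoadFiveBdvCalibrationSplitNFCalibratorSupply

open scoped MatrixGroups NumberField Matrix
open Literature.NumberTheory.GaloisRepresentations
open Literature.NumberTheory.EllipticCurves
open Literature.NumberTheory.EllipticCurves.ModularForms
open IsDedekindDomain Field

/-! ## B  Docking: the CM calibrator of `CalibratorSupplyNF` (BSTW24 App. B currency)

For a weight-two newform `g ∈ S₂(Γ₀(N))` with CM by an imaginary quadratic field `K`
(`χ_K(ℓ) a_ℓ = a_ℓ` for primes `ℓ ∤ N` — verbatim the CM clause of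
`BurungaleSkinnerTianWan2024.prop523proof_appB_exists_orientedCMNewform_PRE`) in which `p`
splits (`SatisfiesHeegnerHypothesis p K`, loc. cit.), the traces of `ρ = ρ_{g,ι'}` vanish off
`Γ_K ≤ Γ_ℚ`: by Čebotarev (`absoluteGaloisGroup.frobenius_dense`, PROVED in the tree from
`chebotarevArtinRep_holds`) the good Frobenii are dense; a Frobenius `Frob_ℓ ∉ Γ_K` sits at an
inert `ℓ` (`exists_place_inert_of_not_mem_range`), so `(d_K/ℓ) ≠ 1`, `χ_K(ℓ) ≠ 1`, `a_ℓ = 0`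
and `tr ρ(Frob_ℓ) = ι'(a_ℓ) = 0` (Deligne, `IsGaloisRepOfNewform1`); `Γ_K ∪ {tr ρ = 0}` is closed.
And `I_p ≤ Γ_K` because `p` is unramified in `K`.  Part A then gives residual absolute
irreducibility.  Remaining hypotheses = typer debts, see `Lines/calibrator_Firr_print.md`:
`hW` (GRANTED Hida 2000 Thm 3.26(2), the cell's standard printed fact), `hirr` (char-0
irreducibility of `ρ_{g,ι'}`: Ribet 1977 Thm 2.3, typed in the tree only for finite `E/ℚ_ℓ`). -/

section Docking

open Rat.HeightOneSpectrum (primesEquiv natGenerator)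

/-- Coefficient `1` of the Hecke polynomial `X² − a_q X + ε(q) q^{k-1}` is `−a_q`. [folklore] -/
theorem heckePolynomial_coeff_one {N : ℕ} [NeZero N] {k : ℤ}
    (f : CuspForm (CongruenceSubgroup.Gamma1 N) k) (q : ℕ) :
    (heckePolynomial f q).coeff 1 =
      -⟨(UpperHalfPlane.qExpansion 1 ⇑f).coeff q, cuspCoeff_mem_coeffCharField f q⟩ := by
  simp [heckePolynomial, Polynomial.coeff_C, Polynomial.coeff_X_pow]

/-- **Theorem B (F-irr for the CM calibrator).**  Let `g ∈ S₂(Γ₀(N))` be a newform, `p ∤ 2N`,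
`ι' : ℚ̄_p ≃ ℂ`, `ρ : Γ_ℚ → GL₂(ℚ̄_p)` attached to `g` away from `N p` (Deligne) and irreducible,
`a_p(g)` a `p`-adic unit (ordinarity), and suppose `g` has CM by an imaginary quadratic `K` in
which `p` splits — hypotheses `hK`, `hpK`, `χK`, `hχK`, `hCM` are VERBATIM the `K`-clause of
`prop523proof_appB_exists_orientedCMNewform_PRE` (BSTW24 App. B).  Then `ρ̄ ⊗ \bar k` is
irreducible for every extension `k'` of the residue field, i.e. `ρ.IsResiduallyAbsIrreducible` —
the conjunct «F-irr» of `CalibratorSupplyNF` (typer memo TY-SNF gap #4), modulo the GRANTED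
printed fact `hW` and the char-0 irreducibility `hirr`.
[cite: Hida2000, Thm. 3.26 (2), p. 152] [cite: Ribet1977, Thm. (2.3)]
[cite: BurungaleSkinnerTianWan2024, Prop. 5.23 and App. B] -/
theorem isResiduallyAbsIrreducible_of_CM (hW : Hida2000_thm326_ordinary_unitRoot)
    {N : ℕ} [NeZero N] (g : CuspForm (CongruenceSubgroup.Gamma0 N) 2) (hg : IsNewform0 g)
    (p : ℕ) [Fact p.Prime] (hp2 : p ≠ 2) (hpN : ¬ p ∣ N) (ι' : PadicAlgCl p ≃+* ℂ)
    (hap : ‖ι'.symm (cuspCoeff g p)‖ = 1)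
    (ρ : FramedGaloisRep ℚ (PadicAlgCl p) 2)
    (hρ : IsGaloisRepOfNewform1 (liftToGamma1 N 2 g)
      (ι'.symm.toRingHom.comp (algebraMap (coeffCharField (liftToGamma1 N 2 g)) ℂ))
      {ℓ : ℕ | ℓ ∣ N * p} ρ)
    (hirr : ρ.toGaloisRep.IsIrreducible)
    {K : Type} [Field K] [NumberField K] (hK : IsImaginaryQuadratic K)
    (hpK : SatisfiesHeegnerHypothesis p K)
    (χK : DirichletCharacter ℂ (NumberField.discr K).natAbs)
    (hχK : ∀ n : ℕ, Odd n → χK n = (jacobiSym (NumberField.discr K) n : ℂ))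
    (hCM : ∀ ℓ : ℕ, ℓ.Prime → ¬ ℓ ∣ N → χK ℓ * cuspCoeff g ℓ = cuspCoeff g ℓ) :
    ρ.IsResiduallyAbsIrreducible := by
  classical
  have hp : p.Prime := Fact.out
  haveI : Algebra.IsQuadraticExtension ℚ K := ⟨hK.1⟩
  -- `Γ₀(N) → Γ₁(N)`
  have hg₁ : IsNewform1 (liftToGamma1 N 2 g) := (isNewform1_liftToGamma1_iff_holds N 2 g).mpr hg
  have hcoe : (⇑(liftToGamma1 N 2 g) : UpperHalfPlane → ℂ) = ⇑g :=
    coe_liftToGamma1_holds (N := N) (k := 2) g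
  have hcoeff : ∀ n : ℕ, (UpperHalfPlane.qExpansion 1 ⇑(liftToGamma1 N 2 g)).coeff n = cuspCoeff g n := by
    intro n
    rw [hcoe]
    rfl
  have hap' : Valued.v (ι'.symm ((UpperHalfPlane.qExpansion 1 ⇑(liftToGamma1 N 2 g)).coeff p)) = 1 := by
    rw [hcoeff, PadicAlgCl.valuation_def, ← NNReal.coe_inj, coe_nnnorm, NNReal.coe_one]
    exact hap
  -- the place `w = (p)` of `ℚ`
  set w : HeightOneSpectrum (𝓞 ℚ) := primesEquiv.symm ⟨p, hp⟩ with hwdef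
  have hwp : ((primesEquiv w : Nat.Primes) : ℕ) = p := by
    rw [hwdef, Equiv.apply_symm_apply]
  have hw : (p : 𝓞 ℚ) ∈ w.asIdeal :=
    (Rat.natCast_mem_asIdeal_iff w).mpr
      (by rw [show natGenerator w = ((primesEquiv w : Nat.Primes) : ℕ) from rfl, hwp])
  -- `H = Γ_K ≤ Γ_ℚ`, of index two
  set H : Subgroup (absoluteGaloisGroup ℚ) := (absGaloisRestrict ℚ K).range with hHdef
  have hHi : H.index = 2 := (index_range_absGaloisRestrict_eq_finrank ℚ K).trans hK.1
  haveI hHn : H.Normal := Subgroup.normal_of_index_eq_two hHi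
  have hH : ∃ γ₀, γ₀ ∉ H := by
    by_contra hall
    push Not at hall
    have h1 : H.index = 1 := Subgroup.index_eq_one.mpr ((Subgroup.eq_top_iff' H).mpr hall)
    omega
  -- inertia at `p` lies in `H` (`p` splits in `K`, so is unramified)
  have hunrp : Algebra.IsUnramifiedIn (𝓞 K) w.asIdeal :=
    Summit.BirchSwinnertonDyer.Rank1Residual.X11b.isUnramifiedIn_of_satisfiesHeegnerHypothesis_of_dvd
      hK hpK hp (dvd_refl p) w hw
  have hI : ∀ σ ∈ absInertia (w.adicCompletion ℚ),
      absGaloisRestrict ℚ (w.adicCompletion ℚ) σ ∈ H := by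
    intro σ hσ
    have hle := inertia_le_range_absGaloisRestrict_of_isUnramifiedIn (K := K) hunrp
      (adicCompletionPrime_mem_primesAbove ℚ w)
    exact hle (by
      rw [inertia_adicCompletionPrime_eq_map_absInertia]
      exact Subgroup.mem_map_of_mem _ hσ)
  -- traces vanish off `H`
  have htr : ∀ γ, γ ∉ H →
      Matrix.trace ((ρ γ : GL (Fin 2) (PadicAlgCl p)) : Matrix (Fin 2) (Fin 2) (PadicAlgCl p)) = 0 := by
    -- the finite exceptional set of places and the dense set of good Frobenii
    set S : Set (HeightOneSpectrum (𝓞 ℚ)) :=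
      {v | ((primesEquiv v : Nat.Primes) : ℕ) ∣ 2 * N * p} ∪
        {v | ¬ Algebra.IsUnramifiedIn (𝓞 K) v.asIdeal} with hSdef
    have hS : S.Finite := by
      refine Set.Finite.union ?_ (finite_setOf_not_isUnramifiedIn ℚ K)
      have hfin : {n : ℕ | n ∣ 2 * N * p}.Finite :=
        (2 * N * p).divisors.finite_toSet.subset fun n hn ↦
          Nat.mem_divisors.mpr ⟨hn, mul_ne_zero (mul_ne_zero two_ne_zero (NeZero.ne N)) hp.ne_zero⟩
      refine (hfin.preimage (f := fun v : HeightOneSpectrum (𝓞 ℚ) ↦ ((primesEquiv v : Nat.Primes) : ℕ))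
        fun v _ w _ h ↦ primesEquiv.injective (Subtype.ext h)).subset ?_
      intro v hv
      exact hv
    set D : Set (absoluteGaloisGroup ℚ) :=
      {σ | ∃ v ∉ S, ∃ 𝔓 ∈ v.primesAbove, IsArithFrobAt (𝓞 ℚ) σ 𝔓} with hDdef
    have hD : Dense D :=
      absoluteGaloisGroup.frobenius_dense
        Literature.NumberTheory.Automorphic.chebotarev_artinRep_of_galoisSide ℚ S hS
    -- the closed set `H ∪ {tr ρ = 0}`
    have hcont : Continuous fun γ : absoluteGaloisGroup ℚ ↦
        Matrix.trace ((ρ γ : GL (Fin 2) (PadicAlgCl p)) : Matrix (Fin 2) (Fin 2) (PadicAlgCl p)) :=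
      (Units.continuous_val.comp (map_continuous ρ)).matrix_trace
    set C : Set (absoluteGaloisGroup ℚ) := (H : Set (absoluteGaloisGroup ℚ)) ∪
      (fun γ : absoluteGaloisGroup ℚ ↦
        Matrix.trace ((ρ γ : GL (Fin 2) (PadicAlgCl p)) : Matrix (Fin 2) (Fin 2) (PadicAlgCl p))) ⁻¹' {0}
      with hCdef
    have hHclosed : IsClosed (H : Set (absoluteGaloisGroup ℚ)) := by
      rw [hHdef, MonoidHom.coe_range]
      exact isClosed_range_absGaloisRestrict (K := ℚ) (L := K)
    have hCclosed : IsClosed C := hHclosed.union (isClosed_singleton.preimage hcont)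
    -- every good Frobenius lies in `C`
    have hDC : D ⊆ C := by
      rintro σ ⟨v, hvS, 𝔓, h𝔓, hσ⟩
      by_cases hσH : σ ∈ H
      · exact Or.inl hσH
      right
      -- the prime `ℓ` under `v`: odd, prime to `N p`, unramified in `K`
      set ℓ : ℕ := ((primesEquiv v : Nat.Primes) : ℕ) with hℓdef
      have hℓ : ℓ.Prime := (primesEquiv v).2
      have hℓv : (ℓ : 𝓞 ℚ) ∈ v.asIdeal := (Rat.natCast_mem_asIdeal_iff v).mpr dvd_rfl
      have hℓ2Np : ¬ ℓ ∣ 2 * N * p := fun h ↦ hvS (Or.inl h)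
      have hunr : Algebra.IsUnramifiedIn (𝓞 K) v.asIdeal := by
        by_contra hn
        exact hvS (Or.inr hn)
      have hℓ2 : ℓ ≠ 2 := by
        intro h2
        apply hℓ2Np
        rw [h2]
        exact dvd_mul_of_dvd_left (dvd_mul_right 2 N) p
      have hℓN : ¬ ℓ ∣ N := fun h ↦ hℓ2Np (dvd_mul_of_dvd_left (dvd_mul_of_dvd_right h 2) p)
      have hℓNp : ¬ ℓ ∣ N * p := fun h ↦ hℓ2Np (by rw [mul_assoc]; exact h.mul_left 2)
      -- `ℓ` is inert in `K` (its Frobenius `σ` is not in `Γ_K`)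
      have hI𝔓 := inertia_le_range_absGaloisRestrict_of_isUnramifiedIn (K := K) hunr h𝔓
      obtain ⟨wK, 𝔔, τ, hwv, -, hdeg, -, -, -, -⟩ :=
        exists_place_inert_of_not_mem_range (F := ℚ) (M := K) (hK.1 ▸ Nat.prime_two) hHn
          (index_range_absGaloisRestrict_eq_finrank ℚ K) hunr h𝔓 hI𝔓 hσ hσH
      rw [hK.1] at hdeg
      have hℓw : ((ℓ : ℕ) : 𝓞 K) ∈ wK.asIdeal := by
        have h1 : ((ℓ : ℕ) : 𝓞 ℚ) ∈ (wK.under (𝓞 ℚ)).asIdeal := by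
          rw [hwv]
          exact hℓv
        rw [HeightOneSpectrum.under_asIdeal, Ideal.under_def, Ideal.mem_comap, map_natCast] at h1
        exact h1
      -- so `(d_K / ℓ) ≠ 1`
      have hj : jacobiSym (NumberField.discr K) ℓ ≠ 1 := by
        intro hj
        haveI := Fact.mk hℓ
        have hsplit :=
          (Literature.NumberTheory.QuadraticFields.Quadratic.ncard_primesOver_eq_two_iff_jacobiSym
            hK.1 hℓ hℓ2).mpr hj
        have hf := (ramificationIdx_eq_one_and_inertiaDeg_eq_one_of_ncard_primesOver_eq_two
          ℓ hK.1 hsplit wK hℓw).2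
        omega
      -- hence `a_ℓ(g) = 0` (CM)
      have ha0 : cuspCoeff g ℓ = 0 := by
        have h := hCM ℓ hℓ hℓN
        rw [hχK ℓ (hℓ.odd_of_ne_two hℓ2)] at h
        have h' : ((jacobiSym (NumberField.discr K) ℓ : ℂ) - 1) * cuspCoeff g ℓ = 0 := by
          linear_combination h
        rcases mul_eq_zero.mp h' with h1 | h1
        · exact absurd (sub_eq_zero.mp h1) (by exact_mod_cast hj)
        · exact h1
      -- and `tr ρ(σ) = ι'(a_ℓ) = 0` (Deligne)
      obtain ⟨-, hchar⟩ := hρ v hℓNp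
      have hc := hchar 𝔓 h𝔓 σ hσ
      change ((ρ σ : GL (Fin 2) (PadicAlgCl p)) : Matrix (Fin 2) (Fin 2) (PadicAlgCl p)).charpoly = _
        at hc
      have htrσ := Matrix.trace_eq_neg_charpoly_coeff
        ((ρ σ : GL (Fin 2) (PadicAlgCl p)) : Matrix (Fin 2) (Fin 2) (PadicAlgCl p))
      rw [Fintype.card_fin] at htrσ
      norm_num at htrσ
      have h0 : (⟨(UpperHalfPlane.qExpansion 1 ⇑(liftToGamma1 N 2 g)).coeff ℓ,
          cuspCoeff_mem_coeffCharField (liftToGamma1 N 2 g) ℓ⟩ :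
            coeffCharField (liftToGamma1 N 2 g)) = 0 := by
        apply Subtype.ext
        change (UpperHalfPlane.qExpansion 1 ⇑(liftToGamma1 N 2 g)).coeff ℓ = 0
        rw [hcoeff, ha0]
      change Matrix.trace ((ρ σ : GL (Fin 2) (PadicAlgCl p)) : Matrix (Fin 2) (Fin 2) (PadicAlgCl p)) = 0
      rw [htrσ, hc, Polynomial.coeff_map, heckePolynomial_coeff_one, map_neg, neg_neg, h0, map_zero]
    -- density: `C` is closed and contains `D`, hence is everything
    intro γ hγ
    have hγC : γ ∈ C := by
      have hcl : γ ∈ closure D := by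
        rw [hD.closure_eq]
        exact Set.mem_univ γ
      exact closure_minimal hDC hCclosed hcl
    rcases hγC with h | h
    · exact absurd h hγ
    · exact h
  exact isResiduallyAbsIrreducible_of_trace_eq_zero_off_subgroup hW (liftToGamma1 N 2 g) hg₁ p hp2 ι'
    hpN hap' ρ hρ hirr H hH htr w hw hI

/-- **Corollary C (supplier currency).**  Theorem B with the CM field packaged EXACTLY as the
existential `K`-conjunct of `BurungaleSkinnerTianWan2024.prop523proof_appB_exists_orientedCMNewform_PRE`
(`∃ K, IsImaginaryQuadratic K ∧ SatisfiesHeegnerHypothesis p K ∧ ∃ χK, χK|odd = (d_K/·) ∧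
∀ ℓ prime, ℓ ∤ N → χK ℓ · a_ℓ = a_ℓ`), so that a prover holding the PRE fact's output
`⟨N, _, g, hg, hpN, -, -, hKcl, hord, -, -⟩` closes the «F-irr» conjunct of `CalibratorSupplyNF`
by `isResiduallyAbsIrreducible_of_CM_clause hW g hg p hp2 hpN ι' (hord ι') ρ hρ hirr hKcl`.
[cite: BurungaleSkinnerTianWan2024, Prop. 5.23 and App. B] [cite: Hida2000, Thm. 3.26 (2), p. 152] -/
theorem isResiduallyAbsIrreducible_of_CM_clause (hW : Hida2000_thm326_ordinary_unitRoot)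
    {N : ℕ} [NeZero N] (g : CuspForm (CongruenceSubgroup.Gamma0 N) 2) (hg : IsNewform0 g)
    (p : ℕ) [Fact p.Prime] (hp2 : p ≠ 2) (hpN : ¬ p ∣ N) (ι' : PadicAlgCl p ≃+* ℂ)
    (hap : ‖ι'.symm (cuspCoeff g p)‖ = 1)
    (ρ : FramedGaloisRep ℚ (PadicAlgCl p) 2)
    (hρ : IsGaloisRepOfNewform1 (liftToGamma1 N 2 g)
      (ι'.symm.toRingHom.comp (algebraMap (coeffCharField (liftToGamma1 N 2 g)) ℂ))
      {ℓ : ℕ | ℓ ∣ N * p} ρ)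
    (hirr : ρ.toGaloisRep.IsIrreducible)
    (hKcl : ∃ (K : Type) (_ : Field K) (_ : NumberField K), IsImaginaryQuadratic K ∧
        SatisfiesHeegnerHypothesis p K ∧
        ∃ χK : DirichletCharacter ℂ (NumberField.discr K).natAbs,
          (∀ n : ℕ, Odd n → χK n = (jacobiSym (NumberField.discr K) n : ℂ)) ∧
          ∀ ℓ : ℕ, ℓ.Prime → ¬ ℓ ∣ N → χK ℓ * cuspCoeff g ℓ = cuspCoeff g ℓ) :
    ρ.IsResiduallyAbsIrreducible := by
  obtain ⟨K, _, _, hK, hpK, χK, hχK, hCM⟩ := hKcl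
  exact isResiduallyAbsIrreducible_of_CM hW g hg p hp2 hpN ι' hap ρ hρ hirr hK hpK χK hχK hCM

end Docking

end Summit.BirchSwinnertonDyer.BirchSwinnertonDyer.Theorems.ErratumRoadFiveBdvCalibrationSplitNFCalibratorSupply
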